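import Literature.MathematicalPhysics.QuantumFieldTheory.Balaban1983to89.B9Eq326OperatorTowerFlat
import Literature.MathematicalPhysics.QuantumFieldTheory.Balaban1983to89.B7Prop4Flat

/-!
# `Balaban1983to89.B9Eq316TowerFlatIsOneStep` — T. Bałaban, *Propagators for lattice gauge theories in a background field*, Commun. Math. Phys.
# **99** (1985) 389–434 [Balaban1985BackgroundPropagators] (3.15)–(3.16), (3.19)–(3.26) pp. 393–395 AT THE FLAT BACKGROUND, with *Propagators
# and renormalization transformations for lattice gauge theories. I*, Commun. Math. Phys. **95** (1984) 17–40 [Balaban1984PropagatorsI] (1.18) p. 20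
# and *Averaging operations for lattice gauge theories*, Commun. Math. Phys. **98** (1985) 17–51 [Balaban1985Averaging] p. 39:
# **THE FLAT `k`-LEVEL TOWER LETTERS ARE THE ONE-STEP LETTERS AT BLOCK SIZE `L^k`** — `Q_k(1)`, `Q′_k(1)`, `R_k(1)` and the flat principal
# gauge-fixed operator `D*D + D R_k(1) D* + aQ_k(1)†Q_k(1)` of the tower `T_{L^k m} → ⋯ → T_m`, read along the period identity
# `towerP L m k = fineP (L^k) m`, ARE the one-step objects of `B9Eq315QTorus` ∕ `B9Eq326OperatorAssembly` with block size `L^k`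

statement-level skeleton of published theorems with citation tags; proofs where landed; nothing here is a claim about the Yang–Mills mass gap

PDF held: `paper:balaban1985-cmp99-background-propagators` (journal page = PDF page + 388) p. 393; `paper:balaban1985-cmp98-averaging` p. 39;
[Balaban1984PropagatorsI] p. 20 through the tree's `B7Prop4Flat` docstrings (verbatim there).
THE PRINT (verbatim).  [B5] p. 20: *«Q₂ is defined as Q only with the number L replaced by L² in all definitions. It is easily seen that a composition of
k transformations is given by (1.17) where (Q_kA)_b = Σ_{x∈B^k(b₋)} η^{d+1} A([x, x(b)])»* (1.18); [B7] p. 39: *«A composition of k operators Q is the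
operator Q_k.»*; [B9] (3.15) p. 393: *«Q_j(U) = Q(Ū^{j−1})…Q(Ū)Q(U)»*, (3.16): *«⟨A, Q*aQA⟩ = Σ_{j=0}^{k} a Σ_{b∈Λ_j} (L^jη)^{d−2} |(Q_j(U)A)(b)|²»* — the
`j`-fold composite lands on the `L^jη`-lattice `Λ_j`, i.e. (at `U = 1`) it IS one averaging with blocks of side `L^j`.

WHY THIS FILE (cell context: `TOWER-SPECIES-PLAN.md` v2 §3 «REDUCTION» of the pub-balaban NE9 owner lineage).  The gen-83 tower files
(`B9Eq326OperatorTowerFlat`, `B9Thm311SmallFieldCoercivityTower`, `B9Eq3126H1BoundTower`, `Support/NE9CurChartTower…`) carry TWO flat constants as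
COMPACTNESS witnesses — the flat coercivity `γ₀` of the `k`-level principal operator (`exists_coercive_principalk_one`, from positivity on a
finite-dimensional space) and the flat modulus `μ_{1,k}` of `Δ^η_1` on `N(Q′_k(1))` (`exists_flat_modulus_tower`) — whereas the ONE-STEP chain has
them EXPLICIT and free of the volume: ne9-leaf-03's S0 `B5Eq190FlatStrongFormTransfer` ([B5] (1.90) with all rows, «γ₀ independent of k») and
ne9-leaf-04's `B9Eq323FlatBlockPoincare.flat_modulus_explicit` (`2∕(Lη)²`).  Both one-step theorems hold for EVERY block size; this file proves that
the flat `k`-level letters ARE the one-step letters at block size `L^k`, so that they port verbatim (sequel `B9Eq326OperatorTowerFlatExplicit`).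

WHAT IS DEFINED AND PROVED (sorry-free; no `Prop` placeholder; no inequality of the papers).
* §1 `towerP_eq_fineP_pow : towerP L m k = fineP (L^k) m` (propositional — `towerP` is the ITERATED refinement, definitionally `fineP L (towerP L m n)`
  one level at a time); the index casts along ANY period identity `h : P = P′`: `siteCast h : TSite d P ≃ TSite d P′`, `bondCast h` (transport of the
  identity; `siteCast_apply_val` — value-preserving; `perCfg_comp_bondCast_symm` — periodic extensions do not see the typing).
* §2 **`QprimeTower_flat_apply`**: `(Q′_n(1) l)(y) = Σ_{x : x_i ∕ L^n = y_i} L^{−nd}·l(x)` (plain block means compose, `(x_i ∕ L) ∕ L^n = x_i ∕ L^{n+1}`);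
  **`QprimeTower_flat_eq_oneStep`**: `Q′_k(1) l = Q′^{(L^k)}(1)(l ∘ cast⁻¹)`.
* §3 `linCovIter_one_left` ((127) at `U₀ = 1` is the flat composite, `linQcov_one_left` level by level) and **`QkOfU_one_eq_oneStep`**:
  `Q_k(1) A = Q^{(L^k)}(1)(A ∘ cast⁻¹)` — both sides read on `ℤ^d` (`B9Eq315QTower.QkOfU_apply_eq_linCovIter`, `B9Eq315QTorus.QtorusLin_apply`), where
  the flat composite is the NE7c crew's **`B7Prop4Flat.linQIter_eq_linQ_pow`** («a composition of k operators Q is the operator Q_k», PROVED there).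
* §4 the weighted `L²` carriers along `P = P′`: `siteL2Cast 𝕜 h`, `bondL2Cast 𝕜 h` (linear, ISOMETRIC: `norm_bondL2Cast`, `inner_bondL2Cast`,
  `norm_siteL2Cast`) and the transport of the lattice operators, all by `subst`: `covDerivL2K_siteL2Cast` ((3.3)), `covDivL2K_bondL2Cast` ((3.8)),
  `norm_covCurlL2K_bondL2Cast` ((3.9)), `RLatticeK_siteL2Cast` ((3.21)), `laplaceALatticeK_bondL2Cast` ((3.26)), `principalOpK_bondL2Cast` ((3.10)),
  `covLaplaceSiteK_one_siteL2Cast` ((3.23)).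
* §5 **THE FLAT `L²` TOWER LETTERS**: `QprimeTowerW_one_eq_oneStep` (`Q′_{n+1}(1) = Q′^{(L^{n+1})}(1) ∘ Φ′`), `QkW_one_eq_oneStep`
  (`Q_{n+1}(1) = Q^{(L^{n+1})}(1) ∘ Φ`), `RofUk_one_eq_oneStep` (`R_{n+1}(1) = Φ′⁻¹ R^{(L^{n+1})}(1) Φ′`), **`principalLaplacek_one_eq_oneStep`**
  (`D*D + D R_{n+1}(1) D* + aQ_{n+1}(1)†Q_{n+1}(1) = Φ⁻¹ ∘ [the one-step operator at block size L^{n+1}] ∘ Φ` — LITERALLY the letter of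
  `B9Eq326OperatorTowerFlat.exists_coercive_principalk_one` on the left and of `B5Eq190FlatStrongFormTransfer` on the right),
  `inner_principalLaplacek_one_eq_oneStep` (the quadratic form), `QprimeTowerW_one_eq_zero_iff` (`N(Q′_{n+1}(1)) = Φ′⁻¹N(Q′^{(L^{n+1})}(1))`).
MODEL ∕ DECLARED READINGS.  (M1) exactly those of `B9Eq315QTower` ∕ `B9Eq326OperatorTower` (periodic readings on `ℤ^d`, normalisations C-adv4-22,
weights `c₀`∕`c₁`, scalar `η⁻¹`); the one-step side's displayed flat data (`hα1′ hU1′ hreg′`, `1 ≤ L^k`) and the tower's (`α hα1 hU1 hreg`) are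
ARBITRARY — the identities hold for any supplied proofs (the values of `QtorusLin`∕`QkOfU` do not depend on them).  (M2) FLAT BACKGROUND ONLY: at
`U ≠ 1` the composite `Q_k(U)` is NOT a one-step averaging (the level backgrounds `Ū^j` differ) — nothing is claimed there.  (M3) the casts are the
identity map across two typings of ONE lattice `(L^k·m_i)_i`; no geometry is changed.
HONEST SCOPE.  [folklore] index bookkeeping between two typed carriers of one printed lattice + the NE7c crew's flat composition law BY NAME; no
estimate of the papers; nothing of [B9] Thm 3.11 at `U ≠ 1`, nothing of print's `k`-uniform SMALL-FIELD statements ((3.35)–(3.37)); «NE9 ⇐ the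
named binders»; NE9 NOT PRINTED ∕ NOT PROVED; NOT summit progress (cell pub-balaban: row NE9 WALLED ON A MODEL; spine PROVED 0∕9; rung (B)+1 finite
T⁴ — NOT infinite volume, NOT mass gap, NOT Clay; HONEST DEPENDENCY: continuum YM on T⁴ ⇐ BetaPertH ∧ nine spine estimates (0/9 proved); BetaPertH ⇐
(D1) ∧ (D4) ∧ CAP+tail; G-an2-4 gates asym, D1 and NE2/3/4).  Filed by the pub-balaban NE9 BINDER-row owner lineage `b2b-balaban-t4-ne9-p1`
(gen 84), INTENT I-ne9p1-g84-1; NEW file importing `B9Eq326OperatorTowerFlat` and `B7Prop4Flat`; modifies nothing.  Net new unproved facts: 0.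
-/

noncomputable section

open scoped InnerProductSpace ComplexConjugate BigOperators

namespace Literature.MathematicalPhysics.QuantumFieldTheory.Balaban1983to89.B9Eq316TowerFlatIsOneStep

open B4Sect5Torus (TSite)
open B9SectCLatticeCarrier (Bond)
open B7Prop1Explicit (U1 Wcx boxVec)
open B7Eq92Concrete (avgIter_one)
open B7Prop3GeneralLinear (linQcov linQcov_one_left)
open B7Prop4GeneralLevels (linCovIter linCovIter_zero linCovIter_succ)
open B7Prop3Flat (linQ)
open B7Prop4Flat (linQIter linQIter_zero linQIter_succ linQIter_eq_linQ_pow norm_linQIter_le)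
open B9Eq311L2Pairing (WL2)
open B9Eq319QprimeTorus (fineP blockOf blockCoord mem_blockOf_iff blockCoord_apply_val Qprime_flat QprimeLin QprimeLin_apply)
open B9Eq315QTorus (perSite perCfg perCfg_apply cornerSite QtorusLin QtorusLin_apply QtorusW)
open B9Eq315QTorusOnto (liftSite cornerSite_eq)
open B9Eq315QTower (towerP towerP_zero towerP_succ towerP_apply UlevOf Qtower QkOfU QkOfU_apply_eq_linCovIter QprimeTower QprimeTower_zero
  QprimeTower_succ corner_eq_smul)
open B9Eq315QTowerFlat (UlevOf_one)
open B9Eq326OperatorAssembly (QprimeW RofU)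
open B9Eq326OperatorTower (QprimeTowerW QkW RofUk laplaceAk)
open B9Eq326OperatorTowerFlat (adTransportW_UlevOf_one equiv_QkW)
open B9Eq310HessianOperator (adTransportW principalOpK covCurlL2K hessOp hessOp_one)
open B11Eq103H1Complex (SiteL2K BondL2K covDerivL2K covDivL2K laplaceALatticeK RLatticeK)
open B5Eq155FlatAveragingCommute (norm_perCfg_le)
open B5Eq172HodgePositivity (adTransportW_one)

variable {d : ℕ}

/-! ## §1 The period identity `towerP L m k = fineP (L^k) m` and the index casts along a period identity -/

/-- **The `k`-th torus of the tower over `m` with block size `L` IS the one-step fine torus over `m` with block size `L^k`**: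
`towerP L m k = fineP (L^k) m` (both `i ↦ L^k·m i`; `towerP_apply`). [cite: Balaban1985Averaging, (1)–(2) p.17; Balaban1985BackgroundPropagators, (3.15)–(3.16) p.393] -/
theorem towerP_eq_fineP_pow (L : ℕ) (m : Fin d → ℕ) (k : ℕ) : towerP L m k = fineP (L ^ k) m :=
  funext fun i => towerP_apply L m k i

section Cast

variable {P P' : Fin d → ℕ}

/-- **The site cast along a period identity `P = P′`** (`TSite d P = Π_i Fin (P i)`): the identity map read across the two typings
(transport along `h`; value-preserving, `siteCast_apply_val`). [cite: Balaban1985Averaging, (1)–(2) p.17] -/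
def siteCast (h : P = P') : TSite d P ≃ TSite d P' := h ▸ Equiv.refl _

/-- At `rfl` the site cast is the identity (the lattice `(P_i)_i` of [B7] (1) under one typing). [cite: Balaban1985Averaging, (1)–(2) p.17] -/
@[simp] theorem siteCast_rfl : siteCast (rfl : P = P) = Equiv.refl _ := rfl

/-- The site cast preserves every coordinate's value (it is the identity of the lattice (1)). [cite: Balaban1985Averaging, (1)–(2) p.17] -/
@[simp] theorem siteCast_apply_val (h : P = P') (x : TSite d P) (i : Fin d) : ((siteCast h x i : ℕ)) = (x i : ℕ) := by
  subst h; rfl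

/-- The inverse site cast is the site cast along the reversed identity. [cite: Balaban1985Averaging, (1)–(2) p.17] -/
theorem siteCast_symm (h : P = P') : (siteCast h).symm = siteCast h.symm := by subst h; rfl

/-- **The bond cast along `P = P′`** (`Bond d P = TSite d P × Fin d`). [cite: Balaban1985Averaging, (1)–(2) p.17] -/
def bondCast (h : P = P') : Bond d P ≃ Bond d P' := h ▸ Equiv.refl _

/-- At `rfl` the bond cast is the identity. [cite: Balaban1985Averaging, (1)–(2) p.17] -/
@[simp] theorem bondCast_rfl : bondCast (rfl : P = P) = Equiv.refl _ := rfl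

/-- The bond cast is the site cast on the base point and the identity on the direction (bonds `⟨x, x + e_κ⟩` of the lattice (1)). [cite: Balaban1985Averaging, (1)–(2) p.17] -/
theorem bondCast_apply (h : P = P') (b : Bond d P) : bondCast h b = (siteCast h b.1, b.2) := by subst h; rfl

/-- The inverse bond cast is the bond cast along the reversed identity. [cite: Balaban1985Averaging, (1)–(2) p.17] -/
theorem bondCast_symm (h : P = P') : (bondCast h).symm = bondCast h.symm := by subst h; rfl

/-- Integer lifts (the sites of `ηℤ^d`, [B7] (1)) are preserved by the site cast. [cite: Balaban1985Averaging, (1)–(2) p.17] -/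
@[simp] theorem liftSite_siteCast (h : P = P') (x : TSite d P) : liftSite (siteCast h x) = liftSite x := by subst h; rfl

/-- **Periodic extensions do not see the typing of the periods**: `perCfg P′ (A ∘ cast⁻¹) = perCfg P A`. [cite: Balaban1985Averaging, (1) p.17] -/
theorem perCfg_comp_bondCast_symm [∀ i, NeZero (P i)] [∀ i, NeZero (P' i)] (h : P = P') {V : Type*} (A : Bond d P → V) :
    perCfg P' (A ∘ (bondCast h).symm) = perCfg P A := by subst h; rfl

end Cast

/-! ## §2 `Q′_k(1)` on the tower IS the block mean over blocks of side `L^k` -/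

section QprimeFlat

variable {V : Type*} [AddCommGroup V] [Module ℂ V] (L : ℕ) [NeZero L] (m : Fin d → ℕ)

omit [NeZero L] in
/-- A fine site lies over the coarse site `y` after `n+1` block-coordinate steps iff its block coordinate lies over `y` after `n` steps
(`(x_i ∕ L) ∕ L^n = x_i ∕ L^{n+1}`). [cite: Balaban1985Averaging, (2) p.17] -/
theorem div_pow_succ_iff (n : ℕ) (x : TSite d (fineP L (towerP L m n))) (y : TSite d m) :
    (∀ i, (x i : ℕ) / L ^ (n + 1) = (y i : ℕ)) ↔ ∀ i, ((blockCoord L (towerP L m n) x i : ℕ)) / L ^ n = (y i : ℕ) := by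
  refine forall_congr' fun i => ?_
  rw [blockCoord_apply_val, Nat.div_div_eq_div_mul, ← pow_succ']

omit [NeZero L] in
/-- Over a coarse site `z` lying over `y` after `n` steps, the fine sites lying over `y` after `n+1` steps with block coordinate `z` are exactly the
block of `z`. [cite: Balaban1985Averaging, (2)–(4) pp.17–18] -/
theorem filter_blockCoord_eq_blockOf (n : ℕ) (y : TSite d m) {z : TSite d (towerP L m n)} (hz : ∀ i, (z i : ℕ) / L ^ n = (y i : ℕ)) :
    (Finset.univ.filter (fun x : TSite d (fineP L (towerP L m n)) => ∀ i, (x i : ℕ) / L ^ (n + 1) = (y i : ℕ))).filter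
        (fun x => blockCoord L (towerP L m n) x = z) = B9Eq319QprimeTorus.blockOf L (towerP L m n) z := by
  ext x
  rw [Finset.mem_filter, Finset.mem_filter, mem_blockOf_iff]
  constructor
  · exact fun hx => hx.2
  · intro hx
    refine ⟨⟨Finset.mem_univ _, (div_pow_succ_iff L m n x y).2 ?_⟩, hx⟩
    rw [hx]; exact hz

/-- **THE FLAT COMPOSITE SITE AVERAGING IS THE BIG BLOCK MEAN**: `(Q′_n(1) l)(y) = Σ_{x : x_i ∕ L^n = y_i ∀ i} L^{−nd} · l(x)` — `n` plain block
means of side `L` compose to the plain block mean of side `L^n` ([B5] p. 20 «Q₂ is defined as Q only with the number L replaced by L²»).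
[cite: Balaban1984PropagatorsI, (1.16)–(1.18) p.20; Balaban1985BackgroundPropagators, (3.19) p.393] -/
theorem QprimeTower_flat_apply : ∀ (n : ℕ) (l : TSite d (towerP L m n) → V) (y : TSite d m),
    QprimeTower L m (fun _ _ => (LinearMap.id : V →ₗ[ℂ] V)) n l y =
      ∑ x ∈ Finset.univ.filter (fun x : TSite d (towerP L m n) => ∀ i, (x i : ℕ) / L ^ n = (y i : ℕ)), (((L : ℝ) ^ n) ^ d)⁻¹ • l x
  | 0, l, y => by
    change l y = ∑ x ∈ Finset.univ.filter (fun x : TSite d m => ∀ i, (x i : ℕ) / L ^ 0 = (y i : ℕ)), (((L : ℝ) ^ 0) ^ d)⁻¹ • l x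
    have hfil : Finset.univ.filter (fun x : TSite d m => ∀ i, (x i : ℕ) / L ^ 0 = (y i : ℕ)) = {y} := by
      ext x
      simp only [Finset.mem_filter, Finset.mem_univ, true_and, Finset.mem_singleton, pow_zero, Nat.div_one]
      constructor
      · intro hx; funext i; exact Fin.ext (hx i)
      · rintro rfl i; rfl
    rw [hfil, Finset.sum_singleton, pow_zero, one_pow, inv_one, one_smul]
  | n + 1, l, y => by
    have hid : (fun _ : Bond d (fineP L (towerP L m n)) => ((LinearMap.id : V →ₗ[ℂ] V)).restrictScalars ℝ) =
        fun _ => (LinearMap.id : V →ₗ[ℝ] V) := rfl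
    change QprimeTower L m (fun _ _ => (LinearMap.id : V →ₗ[ℂ] V)) n
        (QprimeLin L (towerP L m n) (fun _ : Bond d (fineP L (towerP L m n)) => (LinearMap.id : V →ₗ[ℂ] V)) l) y =
      ∑ x ∈ Finset.univ.filter (fun x : TSite d (fineP L (towerP L m n)) => ∀ i, (x i : ℕ) / L ^ (n + 1) = (y i : ℕ)),
        (((L : ℝ) ^ (n + 1)) ^ d)⁻¹ • l x
    rw [QprimeTower_flat_apply n, QprimeLin_apply, hid]
    simp_rw [Qprime_flat, Finset.smul_sum, smul_smul]
    rw [← Finset.sum_fiberwise_of_maps_to (g := blockCoord L (towerP L m n))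
      (t := Finset.univ.filter (fun z : TSite d (towerP L m n) => ∀ i, (z i : ℕ) / L ^ n = (y i : ℕ)))
      (s := Finset.univ.filter (fun x : TSite d (fineP L (towerP L m n)) => ∀ i, (x i : ℕ) / L ^ (n + 1) = (y i : ℕ)))
      (f := fun x => (((L : ℝ) ^ (n + 1)) ^ d)⁻¹ • l x) ?_]
    · refine Finset.sum_congr rfl fun z hz => ?_
      rw [Finset.mem_filter] at hz
      rw [filter_blockCoord_eq_blockOf L m n y hz.2]
      refine Finset.sum_congr rfl fun x _ => ?_
      rw [pow_succ, mul_pow, mul_inv]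
    · intro x hx
      rw [Finset.mem_filter] at hx ⊢
      exact ⟨Finset.mem_univ _, (div_pow_succ_iff L m n x y).1 hx.2⟩

/-- **`Q′_k(1)` ON THE TOWER IS THE ONE-STEP `Q′(1)` AT BLOCK SIZE `L^k`** along the site cast `TSite d (towerP L m k) ≃ TSite d (fineP (L^k) m)`:
`Q′_k(1) l = Q′^{(L^k)}(1)(l ∘ cast⁻¹)`. [cite: Balaban1984PropagatorsI, (1.18) p.20; Balaban1985BackgroundPropagators, (3.19) p.393] -/
theorem QprimeTower_flat_eq_oneStep (k : ℕ) (h : towerP L m k = fineP (L ^ k) m) (l : TSite d (towerP L m k) → V) :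
    QprimeTower L m (fun _ _ => (LinearMap.id : V →ₗ[ℂ] V)) k l =
      QprimeLin (L ^ k) m (fun _ : Bond d (fineP (L ^ k) m) => (LinearMap.id : V →ₗ[ℂ] V)) (l ∘ (siteCast h).symm) := by
  have hid : (fun _ : Bond d (fineP (L ^ k) m) => ((LinearMap.id : V →ₗ[ℂ] V)).restrictScalars ℝ) = fun _ => (LinearMap.id : V →ₗ[ℝ] V) := rfl
  funext y
  rw [QprimeTower_flat_apply, QprimeLin_apply, hid, Qprime_flat]
  refine Finset.sum_equiv (siteCast h) (fun x => ?_) (fun x _ => ?_)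
  · simp only [Finset.mem_filter, Finset.mem_univ, true_and, mem_blockOf_iff]
    constructor
    · intro hx; funext i; apply Fin.ext; rw [blockCoord_apply_val, siteCast_apply_val]; exact hx i
    · intro hx i; rw [← hx, blockCoord_apply_val, siteCast_apply_val]
  · rw [Function.comp_apply, Equiv.symm_apply_apply, Nat.cast_pow]

end QprimeFlat

/-! ## §3 `Q_k(1)` on the tower IS the one-step `Q(1)` at block size `L^k` -/

section QFlat

variable {𝔸 : Type*} [NormedRing 𝔸] [NormedAlgebra ℂ 𝔸] [CompleteSpace 𝔸] [NormOneClass 𝔸]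

/-- **The composite (127) at the flat background IS the flat composite `linQIter`** for a bounded field (each `Ū^j(1) = 1`, and the linear part
of the covariant average at `V₀ = 1` is the plain one, `linQcov_one_left`). [cite: Balaban1985Averaging, (127) p.37, (125) p.36] -/
theorem linCovIter_one_left (L : ℕ) (hL : 1 ≤ L) (B : B7Prop1Explicit.Site d → Fin d → 𝔸) {b : ℝ} (hb : 0 ≤ b)
    (hB : ∀ x κ, ‖B x κ‖ ≤ b) : ∀ j : ℕ, linCovIter L (1 : B7Prop1Explicit.Site d → Fin d → 𝔸ˣ) B j = linQIter L B j
  | 0 => rfl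
  | j + 1 => by
    funext z κ
    rw [linCovIter_succ, linQIter_succ, avgIter_one, linCovIter_one_left L hL B hb hB j]
    exact linQcov_one_left L hL _ (by positivity) (norm_linQIter_le L hL B hb hB j) _ _

variable (L : ℕ) [NeZero L] (m : Fin d → ℕ) [∀ i, NeZero (m i)] (hL : 1 ≤ L) (k : ℕ)
  (α : ℕ → ℝ) (hα1 : ∀ n, α n ≤ 1 / 64)
  (hU1 : ∀ (n : ℕ) (x : B7Prop1Explicit.Site d) (κ : Fin d),
    perCfg (towerP L m (n + 1)) (UlevOf L m k (fun _ : Bond d (towerP L m k) => (1 : 𝔸ˣ)) n) x κ ∈ U1 𝔸)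
  (hreg : ∀ (n : ℕ) (y : TSite d (towerP L m n)) (κ : Fin d) (r : Fin d → Fin L),
    ‖((Wcx L (perCfg (towerP L m (n + 1)) (UlevOf L m k (fun _ : Bond d (towerP L m k) => (1 : 𝔸ˣ)) n)) (cornerSite L y) κ
      (boxVec L r) : 𝔸ˣ) : 𝔸) - 1‖ ≤ α n)
  (hLk : 1 ≤ L ^ k) {α' : ℝ} (hα1' : α' ≤ 1 / 64)
  (hU1' : ∀ (x : B7Prop1Explicit.Site d) (κ : Fin d), perCfg (fineP (L ^ k) m) (fun _ : Bond d (fineP (L ^ k) m) => (1 : 𝔸ˣ)) x κ ∈ U1 𝔸)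
  (hreg' : ∀ (y : TSite d m) (κ : Fin d) (r : Fin d → Fin (L ^ k)),
    ‖((Wcx (L ^ k) (perCfg (fineP (L ^ k) m) (fun _ : Bond d (fineP (L ^ k) m) => (1 : 𝔸ˣ))) (cornerSite (L ^ k) y) κ
      (boxVec (L ^ k) r) : 𝔸ˣ) : 𝔸) - 1‖ ≤ α')

include hL in
/-- **`Q_k(1)` ON THE TOWER IS THE ONE-STEP `Q(1)` AT BLOCK SIZE `L^k`** — [B5] (1.18) «(Q_kA)_b = Σ_{x∈B^k(b₋)} η^{d+1} A([x, x(b)])», [B7] p. 39 «A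
composition of k operators Q is the operator Q_k» — for the cell's typed objects: along the bond cast `Bond d (towerP L m k) ≃ Bond d (fineP (L^k) m)`,
`Q_k(1) A = Q^{(L^k)}(1)(A ∘ cast⁻¹)`, whatever displayed per-level ∕ one-step data are supplied (the values do not depend on them).  Proof: both sides
are read on `ℤ^d` (`QkOfU_apply_eq_linCovIter`, `QtorusLin_apply`), where the flat composite is the NE7c crew's `B7Prop4Flat.linQIter_eq_linQ_pow`.
[cite: Balaban1984PropagatorsI, (1.18) p.20; Balaban1985Averaging, p.39, (127) p.37; Balaban1985BackgroundPropagators, (3.15)–(3.16) p.393] -/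
theorem QkOfU_one_eq_oneStep (h : towerP L m k = fineP (L ^ k) m) (A : Bond d (towerP L m k) → 𝔸) :
    QkOfU L m hL k (fun _ : Bond d (towerP L m k) => (1 : 𝔸ˣ)) α hα1 hU1 hreg A =
      QtorusLin (L ^ k) m hLk (fun _ : Bond d (fineP (L ^ k) m) => (1 : 𝔸ˣ)) hα1' hU1' hreg' (A ∘ (bondCast h).symm) := by
  -- the common bound of the periodic extension
  set B := perCfg (towerP L m k) A with hB
  have hb : 0 ≤ ∑ b : Bond d (towerP L m k), ‖A b‖ := Finset.sum_nonneg fun _ _ => norm_nonneg _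
  have hBb : ∀ x κ, ‖B x κ‖ ≤ ∑ b : Bond d (towerP L m k), ‖A b‖ := norm_perCfg_le A
  have h1 : perCfg (towerP L m k) (fun _ : Bond d (towerP L m k) => (1 : 𝔸ˣ)) = 1 := rfl
  have h1' : perCfg (fineP (L ^ k) m) (fun _ : Bond d (fineP (L ^ k) m) => (1 : 𝔸ˣ)) = 1 := rfl
  funext c
  rw [QkOfU_apply_eq_linCovIter, QtorusLin_apply, h1, h1', perCfg_comp_bondCast_symm h A, ← hB,
    linCovIter_one_left L hL B hb hBb k, linQIter_eq_linQ_pow, linQcov_one_left (L ^ k) hLk B hb hBb, cornerSite_eq, corner_eq_smul]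
  simp only [Nat.cast_pow]

end QFlat

/-! ## §4 The weighted `L²` carriers along a period identity: linear isometries, and the transport of the lattice operators -/

section L2Cast

variable (𝕜 : Type*) [RCLike 𝕜] {P P' : Fin d → ℕ} {c₀ : ℝ} {W : Type*} [NormedAddCommGroup W] [InnerProductSpace 𝕜 W]

/-- **The `L²` site-function cast along `P = P′`** (the identity map across the two typings of ONE torus's `L²` space (3.11)). [cite: Balaban1985BackgroundPropagators, (3.11) p.392] -/
def siteL2Cast (h : P = P') : SiteL2K 𝕜 d P c₀ W ≃ₗ[𝕜] SiteL2K 𝕜 d P' c₀ W := h ▸ LinearEquiv.refl 𝕜 _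

/-- **The `L²` bond-function cast along `P = P′`** (the `L²` space (3.11) under two typings). [cite: Balaban1985BackgroundPropagators, (3.11) p.392] -/
def bondL2Cast (h : P = P') : BondL2K 𝕜 d P c₀ W ≃ₗ[𝕜] BondL2K 𝕜 d P' c₀ W := h ▸ LinearEquiv.refl 𝕜 _

/-- At `rfl` the site `L²` cast is the identity. [cite: Balaban1985BackgroundPropagators, (3.11) p.392] -/
@[simp] theorem siteL2Cast_rfl : siteL2Cast 𝕜 (rfl : P = P) = LinearEquiv.refl 𝕜 (SiteL2K 𝕜 d P c₀ W) := rfl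

/-- At `rfl` the bond `L²` cast is the identity. [cite: Balaban1985BackgroundPropagators, (3.11) p.392] -/
@[simp] theorem bondL2Cast_rfl : bondL2Cast 𝕜 (rfl : P = P) = LinearEquiv.refl 𝕜 (BondL2K 𝕜 d P c₀ W) := rfl

/-- The site `L²` cast reads pointwise through the site cast: `(Φ′ l)(x′) = l(cast⁻¹ x′)`. [cite: Balaban1985BackgroundPropagators, (3.11) p.392] -/
theorem equiv_siteL2Cast (h : P = P') (l : SiteL2K 𝕜 d P c₀ W) :
    WL2.equiv 𝕜 _ W (siteL2Cast 𝕜 h l) = WL2.equiv 𝕜 _ W l ∘ (siteCast h).symm := by subst h; rfl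

/-- The bond `L²` cast reads pointwise through the bond cast: `(Φ f)(b′) = f(cast⁻¹ b′)`. [cite: Balaban1985BackgroundPropagators, (3.11) p.392] -/
theorem equiv_bondL2Cast (h : P = P') (f : BondL2K 𝕜 d P c₀ W) :
    WL2.equiv 𝕜 _ W (bondL2Cast 𝕜 h f) = WL2.equiv 𝕜 _ W f ∘ (bondCast h).symm := by subst h; rfl

variable [Fact (0 < c₀)]

/-- **The bond `L²` cast is an isometry** (same weight `c₀` on both typings). [cite: Balaban1985BackgroundPropagators, (3.11) p.392] -/
@[simp] theorem norm_bondL2Cast (h : P = P') (f : BondL2K 𝕜 d P c₀ W) : ‖bondL2Cast 𝕜 h f‖ = ‖f‖ := by subst h; rfl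

/-- The bond `L²` cast preserves scalar products. [cite: Balaban1985BackgroundPropagators, (3.11) p.392] -/
@[simp] theorem inner_bondL2Cast (h : P = P') (f g : BondL2K 𝕜 d P c₀ W) : ⟪bondL2Cast 𝕜 h f, bondL2Cast 𝕜 h g⟫_𝕜 = ⟪f, g⟫_𝕜 := by
  subst h; rfl

/-- **The site `L²` cast is an isometry.** [cite: Balaban1985BackgroundPropagators, (3.11) p.392] -/
@[simp] theorem norm_siteL2Cast (h : P = P') (l : SiteL2K 𝕜 d P c₀ W) : ‖siteL2Cast 𝕜 h l‖ = ‖l‖ := by subst h; rfl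

/-- **(3.3) `D` does not see the typing of the periods**: `D_{R′}(Φ′ l) = Φ (D_{R′ ∘ cast} l)`. [cite: Balaban1985BackgroundPropagators, (3.3) pp.390–391] -/
theorem covDerivL2K_siteL2Cast (h : P = P') (c : 𝕜) (R' : Bond d P' → W →ₗ[𝕜] W) (l : SiteL2K 𝕜 d P c₀ W) :
    covDerivL2K 𝕜 c₀ c R' (siteL2Cast 𝕜 h l) = bondL2Cast 𝕜 h (covDerivL2K 𝕜 c₀ c (R' ∘ bondCast h) l) := by subst h; rfl

/-- **(3.8) `D*` does not see the typing of the periods**: `D*_{S′}(Φ f) = Φ′ (D*_{S′ ∘ cast} f)`. [cite: Balaban1985BackgroundPropagators, (3.8) p.392] -/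
theorem covDivL2K_bondL2Cast (h : P = P') (c : 𝕜) (S' : Bond d P' → W →ₗ[𝕜] W) (f : BondL2K 𝕜 d P c₀ W) :
    covDivL2K 𝕜 c₀ c S' (bondL2Cast 𝕜 h f) = siteL2Cast 𝕜 h (covDivL2K 𝕜 c₀ c (S' ∘ bondCast h) f) := by subst h; rfl

/-- **(3.9) the curl's norm does not see the typing of the periods**: `‖∂_{R′}(Φ f)‖ = ‖∂_{R′ ∘ cast} f‖`. [cite: Balaban1985BackgroundPropagators, (3.9) p.392] -/
theorem norm_covCurlL2K_bondL2Cast (h : P = P') (c : 𝕜) (R' : Bond d P' → W →ₗ[𝕜] W) (f : BondL2K 𝕜 d P c₀ W) :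
    ‖covCurlL2K 𝕜 c₀ c R' (bondL2Cast 𝕜 h f)‖ = ‖covCurlL2K 𝕜 c₀ c (R' ∘ bondCast h) f‖ := by subst h; rfl

/-- `‖D*_{S′}(Φ f)‖ = ‖D*_{S′ ∘ cast} f‖`. [cite: Balaban1985BackgroundPropagators, (3.8) p.392] -/
theorem norm_covDivL2K_bondL2Cast (h : P = P') (c : 𝕜) (S' : Bond d P' → W →ₗ[𝕜] W) (f : BondL2K 𝕜 d P c₀ W) :
    ‖covDivL2K 𝕜 c₀ c S' (bondL2Cast 𝕜 h f)‖ = ‖covDivL2K 𝕜 c₀ c (S' ∘ bondCast h) f‖ := by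
  rw [covDivL2K_bondL2Cast, norm_siteL2Cast]

variable [FiniteDimensional 𝕜 W]

/-- **(3.21) `R` along a period identity**: conjugating the projection onto `Δ_U N(Q′)` by the site cast is the projection built from the
transported data, `Φ′⁻¹ ∘ R[R′, S′, Q′] ∘ Φ′ = R[R′ ∘ cast, S′ ∘ cast, Q′ ∘ Φ′]`. [cite: Balaban1985BackgroundPropagators, (3.21)–(3.23) p.394] -/
theorem RLatticeK_siteL2Cast {F' : Type*} [AddCommGroup F'] [Module 𝕜 F'] (h : P = P') (c : 𝕜) (R' S' : Bond d P' → W →ₗ[𝕜] W)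
    (Q' : SiteL2K 𝕜 d P' c₀ W →ₗ[𝕜] F') :
    (siteL2Cast 𝕜 h).symm.toLinearMap ∘ₗ RLatticeK c R' S' Q' ∘ₗ (siteL2Cast 𝕜 h).toLinearMap =
      RLatticeK c (R' ∘ bondCast h) (S' ∘ bondCast h) (Q' ∘ₗ (siteL2Cast 𝕜 h).toLinearMap) := by
  subst h
  simp only [siteL2Cast_rfl, bondCast_rfl, LinearEquiv.refl_symm, LinearEquiv.refl_toLinearMap, LinearMap.comp_id, LinearMap.id_comp,
    Equiv.coe_refl, Function.comp_id]

/-- **(3.26)∕(110) `Δ_{1,a}` along a period identity**: `Φ⁻¹ ∘ Δ_{1,a}[R′, S′, Δ₁, R, Q] ∘ Φ = Δ_{1,a}[R′ ∘ cast, S′ ∘ cast, Φ⁻¹Δ₁Φ, Φ′⁻¹RΦ′, Q ∘ Φ]`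
(the `D`, `D*` and `Q†` slots transported by the isometries). [cite: Balaban1985BackgroundPropagators, (3.26) p.395; Balaban1985Variational, (110) p.294] -/
theorem laplaceALatticeK_bondL2Cast {F : Type*} [NormedAddCommGroup F] [InnerProductSpace 𝕜 F] [FiniteDimensional 𝕜 F] (h : P = P') (c : 𝕜)
    (R' S' : Bond d P' → W →ₗ[𝕜] W) (Δ₁ : BondL2K 𝕜 d P' c₀ W →ₗ[𝕜] BondL2K 𝕜 d P' c₀ W)
    (Rr : SiteL2K 𝕜 d P' c₀ W →ₗ[𝕜] SiteL2K 𝕜 d P' c₀ W) (Q : BondL2K 𝕜 d P' c₀ W →ₗ[𝕜] F) (a : ℝ) :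
    (bondL2Cast 𝕜 h).symm.toLinearMap ∘ₗ laplaceALatticeK c R' S' Δ₁ Rr Q a ∘ₗ (bondL2Cast 𝕜 h).toLinearMap =
      laplaceALatticeK c (R' ∘ bondCast h) (S' ∘ bondCast h)
        ((bondL2Cast 𝕜 h).symm.toLinearMap ∘ₗ Δ₁ ∘ₗ (bondL2Cast 𝕜 h).toLinearMap)
        ((siteL2Cast 𝕜 h).symm.toLinearMap ∘ₗ Rr ∘ₗ (siteL2Cast 𝕜 h).toLinearMap) (Q ∘ₗ (bondL2Cast 𝕜 h).toLinearMap) a := by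
  subst h
  simp only [siteL2Cast_rfl, bondL2Cast_rfl, bondCast_rfl, LinearEquiv.refl_symm, LinearEquiv.refl_toLinearMap, LinearMap.comp_id,
    LinearMap.id_comp, Equiv.coe_refl, Function.comp_id]

end L2Cast

section L2CastPrincipal

variable {P P' : Fin d → ℕ} {c₀ : ℝ} {𝔸 : Type*} [NormedRing 𝔸] [NormedAlgebra ℂ 𝔸]
  {W : Type*} [NormedAddCommGroup W] [InnerProductSpace ℂ W] (φ : W ≃ₗ[ℂ] 𝔸) (η : ℝ)

/-- **(3.10) the principal part `D*D` along a period identity**: `Φ⁻¹ ∘ (D*D)[U′] ∘ Φ = (D*D)[U′ ∘ cast]`. [cite: Balaban1985BackgroundPropagators, (3.10) p.392] -/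
theorem principalOpK_bondL2Cast (h : P = P') (U' : Bond d P' → 𝔸ˣ) :
    (bondL2Cast ℂ h).symm.toLinearMap ∘ₗ principalOpK φ η U' (c₀ := c₀) ∘ₗ (bondL2Cast ℂ h).toLinearMap = principalOpK φ η (U' ∘ bondCast h) := by
  subst h
  simp only [bondL2Cast_rfl, bondCast_rfl, LinearEquiv.refl_symm, LinearEquiv.refl_toLinearMap, LinearMap.comp_id, LinearMap.id_comp,
    Equiv.coe_refl, Function.comp_id]

variable [Fact (0 < c₀)]

/-- The flat curl's norm across the typings: `‖∂(1)(Φ x)‖ = ‖∂(1) x‖`. [cite: Balaban1985BackgroundPropagators, (3.9) p.392, (3.4) p.391] -/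
theorem norm_covCurlL2K_one_bondL2Cast (h : P = P') (c : ℂ) (x : BondL2K ℂ d P c₀ W) :
    ‖covCurlL2K ℂ c₀ c (adTransportW φ (fun _ : Bond d P' => (1 : 𝔸ˣ))) (bondL2Cast ℂ h x)‖ =
      ‖covCurlL2K ℂ c₀ c (adTransportW φ (fun _ : Bond d P => (1 : 𝔸ˣ))) x‖ :=
  norm_covCurlL2K_bondL2Cast ℂ h c _ x

/-- The flat divergence's norm across the typings: `‖D*(1)(Φ x)‖ = ‖D*(1) x‖`. [cite: Balaban1985BackgroundPropagators, (3.8) p.392] -/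
theorem norm_covDivL2K_inv_one_bondL2Cast (h : P = P') (c : ℂ) (x : BondL2K ℂ d P c₀ W) :
    ‖covDivL2K ℂ c₀ c (adTransportW φ (fun _ : Bond d P' => (1 : 𝔸ˣ)⁻¹)) (bondL2Cast ℂ h x)‖ =
      ‖covDivL2K ℂ c₀ c (adTransportW φ (fun _ : Bond d P => (1 : 𝔸ˣ)⁻¹)) x‖ :=
  norm_covDivL2K_bondL2Cast ℂ h c _ x

/-- **(3.23) the flat site Laplacian `Δ^η_1 = D*(1)D(1)` across the typings**: `Δ^η_1(Φ′ l) = Φ′(Δ^η_1 l)`. [cite: Balaban1985BackgroundPropagators, (3.23) p.394] -/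
theorem covLaplaceSiteK_one_siteL2Cast (h : P = P') (c : ℂ) (l : SiteL2K ℂ d P c₀ W) :
    B11Eq103H1Complex.covLaplaceSiteK c (adTransportW φ (fun _ : Bond d P' => (1 : 𝔸ˣ))) (adTransportW φ fun _ : Bond d P' => (1 : 𝔸ˣ)⁻¹)
        (siteL2Cast ℂ h l) =
      siteL2Cast ℂ h (B11Eq103H1Complex.covLaplaceSiteK c (adTransportW φ (fun _ : Bond d P => (1 : 𝔸ˣ)))
        (adTransportW φ fun _ : Bond d P => (1 : 𝔸ˣ)⁻¹) l) := by
  subst h; rfl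

end L2CastPrincipal

/-! ## §5 The flat `L²` tower letters ARE the one-step letters at block size `L^k` -/

section Letters

variable {𝔸 : Type*} [NormedRing 𝔸] [NormedAlgebra ℂ 𝔸] [CompleteSpace 𝔸] [NormOneClass 𝔸]
  (L : ℕ) [NeZero L] (m : Fin d → ℕ) [∀ i, NeZero (m i)] (n : ℕ) (hL : 1 ≤ L)
  {W : Type*} [NormedAddCommGroup W] [InnerProductSpace ℂ W] (φ : W ≃ₗ[ℂ] 𝔸) {c₀ c₁ : ℝ} (η : ℝ)
  (α : ℕ → ℝ) (hα1 : ∀ j, α j ≤ 1 / 64)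
  (hU1 : ∀ (j : ℕ) (x : B7Prop1Explicit.Site d) (κ : Fin d),
    perCfg (towerP L m (j + 1)) (UlevOf L m (n + 1) (fun _ : Bond d (towerP L m (n + 1)) => (1 : 𝔸ˣ)) j) x κ ∈ U1 𝔸)
  (hreg : ∀ (j : ℕ) (y : TSite d (towerP L m j)) (κ : Fin d) (r : Fin d → Fin L),
    ‖((Wcx L (perCfg (towerP L m (j + 1)) (UlevOf L m (n + 1) (fun _ : Bond d (towerP L m (n + 1)) => (1 : 𝔸ˣ)) j)) (cornerSite L y) κ
      (boxVec L r) : 𝔸ˣ) : 𝔸) - 1‖ ≤ α j)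
  (hLk : 1 ≤ L ^ (n + 1)) {α' : ℝ} (hα1' : α' ≤ 1 / 64)
  (hU1' : ∀ (x : B7Prop1Explicit.Site d) (κ : Fin d),
    perCfg (fineP (L ^ (n + 1)) m) (fun _ : Bond d (fineP (L ^ (n + 1)) m) => (1 : 𝔸ˣ)) x κ ∈ U1 𝔸)
  (hreg' : ∀ (y : TSite d m) (κ : Fin d) (r : Fin d → Fin (L ^ (n + 1))),
    ‖((Wcx (L ^ (n + 1)) (perCfg (fineP (L ^ (n + 1)) m) (fun _ : Bond d (fineP (L ^ (n + 1)) m) => (1 : 𝔸ˣ))) (cornerSite (L ^ (n + 1)) y) κ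
      (boxVec (L ^ (n + 1)) r) : 𝔸ˣ) : 𝔸) - 1‖ ≤ α')
  (h : towerP L m (n + 1) = fineP (L ^ (n + 1)) m)

omit [NormOneClass 𝔸] in
/-- **`Q′_{n+1}(1)` on the `L²` gauge parameters IS the one-step `Q′(1)` at block size `L^{n+1}`**: `Q′_{n+1}(1) = Q′^{(L^{n+1})}(1) ∘ Φ′`.
[cite: Balaban1985BackgroundPropagators, (3.19) p.393; Balaban1984PropagatorsI, (1.18) p.20] -/
theorem QprimeTowerW_one_eq_oneStep :
    QprimeTowerW L m n φ (fun _ : Bond d (towerP L m (n + 1)) => (1 : 𝔸ˣ)) (c₀ := c₀) =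
      QprimeW (L ^ (n + 1)) m φ (fun _ : Bond d (fineP (L ^ (n + 1)) m) => (1 : 𝔸ˣ)) ∘ₗ (siteL2Cast ℂ h).toLinearMap := by
  apply LinearMap.ext
  intro l
  have h1 : adTransportW φ (fun _ : Bond d (fineP (L ^ (n + 1)) m) => (1 : 𝔸ˣ)) = fun _ => (LinearMap.id : W →ₗ[ℂ] W) :=
    funext fun b => adTransportW_one φ b
  rw [B9Eq326OperatorTowerFlat.QprimeTowerW_one_apply, QprimeTower_flat_eq_oneStep L m (n + 1) h, LinearMap.comp_apply, QprimeW,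
    LinearMap.comp_apply, h1]
  show _ = QprimeLin (L ^ (n + 1)) m (fun _ => LinearMap.id) (WL2.equiv ℂ _ W (siteL2Cast ℂ h l))
  rw [equiv_siteL2Cast]

include hL in
/-- **`Q_{n+1}(1)` on the weighted `L²` spaces IS the one-step `Q(1)` at block size `L^{n+1}`**: `Q_{n+1}(1) = Q^{(L^{n+1})}(1) ∘ Φ` — whatever
displayed per-level ∕ one-step data are supplied. [cite: Balaban1984PropagatorsI, (1.18) p.20; Balaban1985BackgroundPropagators, (3.15)–(3.16) p.393] -/
theorem QkW_one_eq_oneStep :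
    QkW L m n φ (fun _ : Bond d (towerP L m (n + 1)) => (1 : 𝔸ˣ)) hL α hα1 hU1 hreg (c₀ := c₀) (c₁ := c₁) =
      QtorusW (L ^ (n + 1)) m hLk φ (fun _ : Bond d (fineP (L ^ (n + 1)) m) => (1 : 𝔸ˣ)) hα1' hU1' hreg' ∘ₗ (bondL2Cast ℂ h).toLinearMap := by
  apply LinearMap.ext
  intro f
  apply (WL2.equiv ℂ (fun _ : Bond d m => c₁) W).injective
  funext c
  rw [equiv_QkW, QkOfU_one_eq_oneStep L m hL (n + 1) α hα1 hU1 hreg hLk hα1' hU1' hreg' h, LinearMap.comp_apply, LinearEquiv.coe_toLinearMap,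
    B9Eq315QTorus.QtorusW_apply, equiv_bondL2Cast]
  rfl

variable [FiniteDimensional ℂ W] [Fact (0 < c₀)]

omit [NormOneClass 𝔸] in
/-- **`R_{n+1}(1)` IS the one-step `R(1)` at block size `L^{n+1}`, conjugated by the site isometry**: `R_{n+1}(1) = Φ′⁻¹ ∘ R^{(L^{n+1})}(1) ∘ Φ′`.
[cite: Balaban1985BackgroundPropagators, (3.21)–(3.23) p.394] -/
theorem RofUk_one_eq_oneStep :
    RofUk L m n φ η (fun _ : Bond d (towerP L m (n + 1)) => (1 : 𝔸ˣ)) (c₀ := c₀) =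
      (siteL2Cast ℂ h).symm.toLinearMap ∘ₗ RofU (L ^ (n + 1)) m φ η (fun _ : Bond d (fineP (L ^ (n + 1)) m) => (1 : 𝔸ˣ)) ∘ₗ
        (siteL2Cast ℂ h).toLinearMap := by
  have hR : adTransportW φ (fun _ : Bond d (fineP (L ^ (n + 1)) m) => (1 : 𝔸ˣ)) ∘ bondCast h =
      adTransportW φ (fun _ : Bond d (towerP L m (n + 1)) => (1 : 𝔸ˣ)) := rfl
  have hS : adTransportW φ (fun b : Bond d (fineP (L ^ (n + 1)) m) => ((fun _ => (1 : 𝔸ˣ)) b)⁻¹) ∘ bondCast h =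
      adTransportW φ (fun b : Bond d (towerP L m (n + 1)) => ((fun _ => (1 : 𝔸ˣ)) b)⁻¹) := rfl
  rw [RofU, RLatticeK_siteL2Cast, hR, hS, ← QprimeTowerW_one_eq_oneStep L m n φ h]
  rfl

variable [Fact (0 < c₁)]

include hL in
/-- **MAIN — THE FLAT `(n+1)`-LEVEL PRINCIPAL GAUGE-FIXED OPERATOR IS THE ONE-STEP ONE AT BLOCK SIZE `L^{n+1}`, CONJUGATED BY THE BOND ISOMETRY**:
`D*D + D R_{n+1}(1) D* + a Q_{n+1}(1)†Q_{n+1}(1) = Φ⁻¹ ∘ (D*D + D R^{(L^{n+1})}(1) D* + a Q^{(L^{n+1})}(1)†Q^{(L^{n+1})}(1)) ∘ Φ` — the letter of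
`B9Eq326OperatorTowerFlat.exists_coercive_principalk_one` on the left, the letter of `B5Eq190FlatStrongFormTransfer` (at block size `L^{n+1}`) on the right.
[cite: Balaban1985BackgroundPropagators, (3.26) p.395, (3.15)–(3.16) p.393; Balaban1984PropagatorsI, (1.18) p.20] -/
theorem principalLaplacek_one_eq_oneStep (a : ℝ) :
    laplaceALatticeK ((η : ℂ))⁻¹ (adTransportW φ (fun _ : Bond d (towerP L m (n + 1)) => (1 : 𝔸ˣ)))
        (adTransportW φ fun _ : Bond d (towerP L m (n + 1)) => (1 : 𝔸ˣ)⁻¹) (principalOpK φ η fun _ => 1)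
        (RofUk L m n φ η fun _ : Bond d (towerP L m (n + 1)) => (1 : 𝔸ˣ))
        (QkW L m n φ (fun _ : Bond d (towerP L m (n + 1)) => (1 : 𝔸ˣ)) hL α hα1 hU1 hreg (c₁ := c₁)) a =
      (bondL2Cast ℂ h).symm.toLinearMap ∘ₗ
        laplaceALatticeK ((η : ℂ))⁻¹ (adTransportW φ (fun _ : Bond d (fineP (L ^ (n + 1)) m) => (1 : 𝔸ˣ)))
          (adTransportW φ fun _ : Bond d (fineP (L ^ (n + 1)) m) => (1 : 𝔸ˣ)⁻¹) (principalOpK φ η (c₀ := c₀) fun _ => 1)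
          (RofU (L ^ (n + 1)) m φ η (c₀ := c₀) fun _ => 1)
          (QtorusW (L ^ (n + 1)) m hLk φ (fun _ => 1) hα1' hU1' hreg' (c₀ := c₀) (c₁ := c₁)) a ∘ₗ
        (bondL2Cast ℂ h).toLinearMap := by
  have hR : adTransportW φ (fun _ : Bond d (fineP (L ^ (n + 1)) m) => (1 : 𝔸ˣ)) ∘ bondCast h =
      adTransportW φ (fun _ : Bond d (towerP L m (n + 1)) => (1 : 𝔸ˣ)) := rfl
  have hS : adTransportW φ (fun _ : Bond d (fineP (L ^ (n + 1)) m) => (1 : 𝔸ˣ)⁻¹) ∘ bondCast h =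
      adTransportW φ (fun _ : Bond d (towerP L m (n + 1)) => (1 : 𝔸ˣ)⁻¹) := rfl
  have hU : (fun _ : Bond d (fineP (L ^ (n + 1)) m) => (1 : 𝔸ˣ)) ∘ bondCast h = fun _ : Bond d (towerP L m (n + 1)) => (1 : 𝔸ˣ) := rfl
  rw [laplaceALatticeK_bondL2Cast, hR, hS, principalOpK_bondL2Cast, hU, ← QkW_one_eq_oneStep L m n hL φ α hα1 hU1 hreg hLk hα1' hU1' hreg' h]
  have hRofU : (siteL2Cast ℂ h).symm.toLinearMap ∘ₗ (RofU (L ^ (n + 1)) m φ η (c₀ := c₀) fun _ => 1) ∘ₗ (siteL2Cast ℂ h).toLinearMap =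
      RofUk L m n φ η (fun _ : Bond d (towerP L m (n + 1)) => (1 : 𝔸ˣ)) (c₀ := c₀) :=
    (RofUk_one_eq_oneStep L m n φ η h).symm
  rw [hRofU]

include hL in
/-- **The flat principal quadratic form across the typings**: `⟨Φx, Δ^{(L^{n+1})}_{prin}(1)(Φx)⟩ = ⟨x, Δ^{(n+1)}_{prin}(1)x⟩` — the form in which the
one-step strong flat coercivity ([B5] (1.90) transported, `B5Eq190FlatStrongFormTransfer`) is consumed one storey up.
[cite: Balaban1985BackgroundPropagators, (3.26) p.395, (3.11) p.392; Balaban1984PropagatorsI, (1.18) p.20] -/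
theorem inner_principalLaplacek_one_eq_oneStep (a : ℝ) (x : BondL2K ℂ d (towerP L m (n + 1)) c₀ W) :
    ⟪bondL2Cast ℂ h x,
        laplaceALatticeK ((η : ℂ))⁻¹ (adTransportW φ (fun _ : Bond d (fineP (L ^ (n + 1)) m) => (1 : 𝔸ˣ)))
          (adTransportW φ fun _ : Bond d (fineP (L ^ (n + 1)) m) => (1 : 𝔸ˣ)⁻¹) (principalOpK φ η (c₀ := c₀) fun _ => 1)
          (RofU (L ^ (n + 1)) m φ η (c₀ := c₀) fun _ => 1)
          (QtorusW (L ^ (n + 1)) m hLk φ (fun _ => 1) hα1' hU1' hreg' (c₀ := c₀) (c₁ := c₁)) a (bondL2Cast ℂ h x)⟫_ℂ =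
      ⟪x, laplaceALatticeK ((η : ℂ))⁻¹ (adTransportW φ (fun _ : Bond d (towerP L m (n + 1)) => (1 : 𝔸ˣ)))
        (adTransportW φ fun _ : Bond d (towerP L m (n + 1)) => (1 : 𝔸ˣ)⁻¹) (principalOpK φ η fun _ => 1)
        (RofUk L m n φ η fun _ : Bond d (towerP L m (n + 1)) => (1 : 𝔸ˣ))
        (QkW L m n φ (fun _ : Bond d (towerP L m (n + 1)) => (1 : 𝔸ˣ)) hL α hα1 hU1 hreg (c₁ := c₁)) a x⟫_ℂ := by
  rw [principalLaplacek_one_eq_oneStep L m n hL φ η α hα1 hU1 hreg hLk hα1' hU1' hreg' h a, LinearMap.comp_apply, LinearMap.comp_apply,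
    LinearEquiv.coe_toLinearMap, LinearEquiv.coe_toLinearMap, ← inner_bondL2Cast ℂ h x, LinearEquiv.apply_symm_apply]

end Letters

section KernelLetters

variable {𝔸 : Type*} [NormedRing 𝔸] [NormedAlgebra ℂ 𝔸] [CompleteSpace 𝔸]
  (L : ℕ) [NeZero L] (m : Fin d → ℕ) [∀ i, NeZero (m i)] (n : ℕ)
  {W : Type*} [NormedAddCommGroup W] [InnerProductSpace ℂ W] (φ : W ≃ₗ[ℂ] 𝔸) {c₀ : ℝ}
  (h : towerP L m (n + 1) = fineP (L ^ (n + 1)) m)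

/-- **`N(Q′_{n+1}(1)) = Φ′⁻¹ N(Q′^{(L^{n+1})}(1))`**: a gauge parameter is annihilated by the flat composite site averaging iff its cast is annihilated by
the flat one-step site averaging at block size `L^{n+1}`. [cite: Balaban1985BackgroundPropagators, (3.19)–(3.21) pp.393–394] -/
theorem QprimeTowerW_one_eq_zero_iff (l : SiteL2K ℂ d (towerP L m (n + 1)) c₀ W) :
    QprimeTowerW L m n φ (fun _ : Bond d (towerP L m (n + 1)) => (1 : 𝔸ˣ)) (c₀ := c₀) l = 0 ↔
      QprimeW (L ^ (n + 1)) m φ (fun _ : Bond d (fineP (L ^ (n + 1)) m) => (1 : 𝔸ˣ)) (siteL2Cast ℂ h l) = 0 := by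
  rw [QprimeTowerW_one_eq_oneStep L m n φ h, LinearMap.comp_apply, LinearEquiv.coe_toLinearMap]

end KernelLetters

end Literature.MathematicalPhysics.QuantumFieldTheory.Balaban1983to89.B9Eq316TowerFlatIsOneStep

end
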